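import Summits.BirchSwinnertonDyer.BirchSwinnertonDyer.Theorems.ManinLocalTwoThreeNewformSixtyFour
import Summits.BirchSwinnertonDyer.BirchSwinnertonDyer.Theorems.ManinLocalTwoThreeNewformPinningFortyEight
import Literature.NumberTheory.EllipticCurves.NewformsOldNewProofs
import Literature.NumberTheory.EllipticCurves.ModularFormsGamma0Genus
import HarnessLib

/-!
# Level 64 (`4 ∣ 64`, genus `3`), newform part 2: the newform of every `X₀(64)`-datum is `φ₆₄` — FACT-FREE pinning

Cell bsd-f2-manin, route `ManinLocalTwoThree` (crux C2 `ManinOddAtFour`, stmt-22967), prover seat p3 gen 23; sequel to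
`…NewformSixtyFour` (`φ₆₄` is killed by both adjoint degeneracy maps to level `32`); the level-`64` twin of p2 g26's
`…NewformPinningFortyEight`.

* §4 `φ₆₄ ∈ S₂(Γ₀(64))^{new}` (the remaining adjoint degeneracy maps land in `S₂(Γ₀(M)) = 0`, `M ∣ 64`, `M ∉ {32, 64}`, genus `0`).
* §5 `g(X₀(64)) = 3 = dim S₂(Γ₀(64))` (tree `genusX0_sixtyFour`, `finrank_cuspForm_two_eq_genusX0_holds`); the old subspace
  contains the independent `φ₃₂` and `φ₃₂|diag(2,1) = 2η₈²η₁₆²` (orders `1`, `2` at `∞`); old and new are disjoint (tree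
  `disjoint_oldSubspace0_newSubspace0_holds`) ⟹ `dim new ≤ 1` ⟹ `S₂(Γ₀(64))^{new} = ℂφ₆₄` ⟹ **every newform of level `64` is
  `φ₆₄`, so `D.f = φ₆₄` for every `X₀(64)`-datum `D` of every curve** (`f_eq_phi64`, `f_apply_eq_phi64`).

No definition, no named fact, no sorry.  Nothing here proves C2 for all `N`, Manin's conjecture or BSD.
[cite: AtkinLehner1970, Thm. 5] [cite: DiamondShurman2005, §5.6, Thm. 3.5.1] [cite: MartinOno1997, Thm. 2]
-/

set_option autoImplicit false
-- lint-debt: the directory name repeats the summit name (sibling precedent `ManinLocalTwoThreeNewformPinningFortyEight.lean`)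
set_option linter.dupNamespace false

noncomputable section

open Complex Filter Topology Set Function Asymptotics
open UpperHalfPlane hiding I
open scoped Real Topology Manifold MatrixGroups ModularForm
open ModularForm CongruenceSubgroup Matrix.SpecialLinearGroup
open Literature.NumberTheory.ModularForms
open Literature.NumberTheory.EllipticCurves Literature.NumberTheory.EllipticCurves.ModularForms

namespace Summit.BirchSwinnertonDyer.BirchSwinnertonDyer.Theorems.ManinLocalTwoThree.NewformSixtyFour

open CuspToolkit

/-! ## §4 `φ₆₄` is new -/

/-- `S₂(Γ₀(M)) = 0` for `M ∣ 64`, `M ∉ {32, 64}` (`M ∈ {1,2,4,8,16}`, genus `0`). [cite: DiamondShurman2005, Thm. 3.5.1] -/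
theorem cuspForm_two_eq_zero_of_mem_properDivisors_sixtyFour {M : ℕ} [NeZero M]
    (hM : M ∈ Nat.properDivisors 64) (hM32 : M ≠ 32) (g : CuspForm (Gamma0 M) 2) : g = 0 := by
  have hfd : FiniteDimensional ℂ (CuspForm (Gamma0 M) 2) := finiteDimensional_cuspForm_gamma0 M 2
  rw [show Nat.properDivisors 64 = {1, 2, 4, 8, 16, 32} by decide] at hM
  simp only [Finset.mem_insert, Finset.mem_singleton] at hM
  have h1 : finrank_cuspForm_two_eq_genusX0 M := finrank_cuspForm_two_eq_genusX0_holds M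
  have h2 : genusX0 M = 0 :=
    genusX0_eq_zero_of_mem_genusZeroLevels (by simp only [Finset.mem_insert, Finset.mem_singleton]; omega)
  unfold finrank_cuspForm_two_eq_genusX0 at h1
  rw [h2] at h1
  exact (finrank_zero_iff_forall_zero.mp h1) g

/-- **`φ₆₄ ∈ S₂(Γ₀(64))^{new}`** (joint kernel of all adjoint degeneracy maps) — FACT-FREE. [cite: AtkinLehner1970, Thm. 5] -/
theorem mem_newSubspace0_phi64 (φ : CuspForm (Gamma0 64) 2)
    (hφ : ⇑φ = etaQuotient 64 (expFn [(4, -2), (8, 8), (16, -2)])) :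
    φ ∈ newSubspace0 64 2 := by
  rw [newSubspace0, Submodule.mem_iInf]
  rintro ⟨⟨M, d⟩, hM, hMd⟩
  haveI hM0 : NeZero M := ⟨(Nat.pos_of_mem_properDivisors hM).ne'⟩
  haveI hd0 : NeZero d := ⟨fun h ↦ by simp [h] at hMd⟩
  haveI : NeZero (M, d).1 := hM0
  haveI : NeZero (M, d).2 := hd0
  rw [LinearMap.mem_ker]
  dsimp only
  by_cases hM32 : M = 32
  · subst hM32
    have hd : d = 1 ∨ d = 2 := by
      have hd2 : d ∣ 2 := by
        have h64 : (32 * d) ∣ 32 * 2 := hMd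
        exact Nat.dvd_of_mul_dvd_mul_left (by norm_num) h64
      have hdle := Nat.le_of_dvd two_pos hd2
      interval_cases d
      · exact absurd hd2 (by decide)
      · exact Or.inl rfl
      · exact Or.inr rfl
    rcases hd with rfl | rfl
    · exact adjDegeneracyMap0_one_phi64 φ hφ
    · exact adjDegeneracyMap0_two_phi64 φ hφ
  · exact cuspForm_two_eq_zero_of_mem_properDivisors_sixtyFour hM hM32 _

/-! ## §5 `dim S₂(Γ₀(64)) = 3`, the old part has dimension `≥ 2`, so every newform of level `64` is `φ₆₄` -/

/-- **`dim S₂(Γ₀(64)) = 3`** (`g(X₀(64)) = 3`, tree). [cite: DiamondShurman2005, Thm. 3.5.1] -/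
theorem finrank_cuspForm_two_sixtyFour : Module.finrank ℂ (CuspForm (Gamma0 64) 2) = 3 := by
  have h := finrank_cuspForm_two_eq_genusX0_holds 64
  unfold finrank_cuspForm_two_eq_genusX0 at h
  rw [h, genusX0_sixtyFour]

/-- `ι₁ φ₃₂ = φ₃₂` pointwise (degeneracy map at `d = 1`). [cite: DiamondShurman2005, §5.6] -/
theorem degeneracyMap0_one_phi32_apply (τ : ℍ) :
    degeneracyMap0 32 64 1 2 cuspFormEtaProductThirtyTwo τ = cuspFormEtaProductThirtyTwo τ :=
  congr_fun (coe_degeneracyMap0_one 32 64 2 (by norm_num) cuspFormEtaProductThirtyTwo) τ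

/-- `E_d(2τ) = E_{2d}(τ)` at the point `diag(2,1)·τ = 2τ` (`q(2τ) = q(τ)²`). [folklore] -/
theorem eulerFn_tpD_two (d : ℕ) (τ : ℍ) : eulerFn d (tpD 2 • τ) = eulerFn (2 * d) τ := by
  rw [eulerFn, eulerFn, coe_tpD_smul, qParam_one_natCast_mul, ← pow_mul]

/-- `q(2τ) = q(τ)²` at the point `diag(2,1)·τ`. [folklore] -/
theorem qParam_tpD_two (τ : ℍ) : Periodic.qParam 1 ((tpD 2 • τ : ℍ) : ℂ) = Periodic.qParam 1 (τ : ℂ) ^ 2 := by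
  rw [coe_tpD_smul, qParam_one_natCast_mul]

/-- `ι₂ φ₃₂ = 2·q²E₈²E₁₆² = 2·η₈²η₁₆²` pointwise (degeneracy map at `d = 2`: `f ↦ 2f(2τ)`; `φ₃₂ = qE₄²E₈²`).
[cite: DiamondShurman2005, §5.6] -/
theorem degeneracyMap0_two_phi32_apply (τ : ℍ) :
    degeneracyMap0 32 64 2 2 cuspFormEtaProductThirtyTwo τ
      = 2 * (Periodic.qParam 1 (τ : ℂ) ^ 2 * eulerFn 8 τ ^ 2 * eulerFn 16 τ ^ 2) := by
  rw [congr_fun (coe_degeneracyMap0 32 64 2 2 (by norm_num) cuspFormEtaProductThirtyTwo) τ, slash_tpD_apply,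
    EulerRemaindersThirtyTwo.etaProductThirtyTwo_eq (tpD 2 • τ), qParam_tpD_two, eulerFn_tpD_two, eulerFn_tpD_two]
  norm_num

/-- `ι₂ φ₃₂ / q² → 2` at `i∞`. [folklore] -/
theorem tendsto_degeneracyMap0_two_phi32_div :
    Tendsto (fun τ : ℍ ↦ degeneracyMap0 32 64 2 2 cuspFormEtaProductThirtyTwo τ / Periodic.qParam 1 (τ : ℂ) ^ 2)
      atImInfty (𝓝 2) := by
  have h := (((isIntUnitQExp_eulerFn (by norm_num : 0 < 8)).tendsto_one.pow 2).mul
    ((isIntUnitQExp_eulerFn (by norm_num : 0 < 16)).tendsto_one.pow 2)).const_mul 2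
  simp only [one_pow, mul_one] at h
  refine h.congr fun τ ↦ ?_
  have hq := QRemainder.qParam_ne_zero τ
  rw [degeneracyMap0_two_phi32_apply]
  field_simp

/-- `ι₂ φ₃₂ ≠ 0`. [folklore] -/
theorem degeneracyMap0_two_phi32_ne_zero : degeneracyMap0 32 64 2 2 cuspFormEtaProductThirtyTwo ≠ 0 := by
  intro h
  have h1 := congrArg (fun f : CuspForm (Gamma0 64) 2 ↦ f UpperHalfPlane.I) h
  simp only [CuspForm.zero_apply, degeneracyMap0_two_phi32_apply, mul_eq_zero, OfNat.ofNat_ne_zero, false_or,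
    pow_eq_zero_iff, ne_eq, OfNat.ofNat_ne_zero, not_false_eq_true] at h1
  rcases h1 with (h1 | h1) | h1
  · exact QRemainder.qParam_ne_zero _ h1
  · exact eulerFn_ne_zero (by norm_num : 0 < 8) _ h1
  · exact eulerFn_ne_zero (by norm_num : 0 < 16) _ h1

/-- **`ι₁φ₃₂`, `ι₂φ₃₂` are linearly independent** (orders `1` and `2` at `∞`). [folklore] -/
theorem degeneracy_images_independent (a b : ℂ)
    (h : a • degeneracyMap0 32 64 1 2 cuspFormEtaProductThirtyTwo + b • degeneracyMap0 32 64 2 2 cuspFormEtaProductThirtyTwo = 0) :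
    a = 0 ∧ b = 0 := by
  have hq : Tendsto (fun τ : ℍ ↦ Periodic.qParam 1 (τ : ℂ)) atImInfty (𝓝 0) := QRemainder.tendsto_qParam
  have hlim := (GaussStableThirtyTwo.tendsto_etaProductThirtyTwo_div_qParam.const_mul a).add
    ((tendsto_degeneracyMap0_two_phi32_div.const_mul b).mul hq)
  rw [mul_one, mul_zero, add_zero] at hlim
  have hzero : Tendsto (fun τ : ℍ ↦ a * (cuspFormEtaProductThirtyTwo τ / Periodic.qParam 1 (τ : ℂ))
      + b * (degeneracyMap0 32 64 2 2 cuspFormEtaProductThirtyTwo τ / Periodic.qParam 1 (τ : ℂ) ^ 2)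
        * Periodic.qParam 1 (τ : ℂ)) atImInfty (𝓝 0) := by
    refine tendsto_const_nhds.congr fun τ ↦ ?_
    have hτ := congrArg (fun f : CuspForm (Gamma0 64) 2 ↦ f τ) h
    simp only [CuspForm.add_apply, CuspForm.IsGLPos.smul_apply, smul_eq_mul, CuspForm.zero_apply,
      degeneracyMap0_one_phi32_apply] at hτ
    have hq0 : Periodic.qParam 1 (τ : ℂ) ≠ 0 := Complex.exp_ne_zero _
    field_simp
    linear_combination -hτ
  have ha : a = 0 := tendsto_nhds_unique hlim hzero
  refine ⟨ha, ?_⟩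
  rw [ha, zero_smul, zero_add] at h
  rcases smul_eq_zero.mp h with hb | hb
  · exact hb
  · exact absurd hb degeneracyMap0_two_phi32_ne_zero

/-- `ι_d φ₃₂ ∈ S₂(Γ₀(64))^{old}` for `d = 1, 2`. [cite: AtkinLehner1970, §2] -/
theorem degeneracyMap0_phi32_mem_old (d : ℕ) [NeZero d] (hd : d = 1 ∨ d = 2) :
    degeneracyMap0 32 64 d 2 cuspFormEtaProductThirtyTwo ∈ oldSubspace0 64 2 := by
  have hidx : (32, d) ∈ {x : ℕ × ℕ | x.1 ∈ Nat.properDivisors 64 ∧ x.1 * x.2 ∣ 64} := by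
    rcases hd with rfl | rfl <;> decide
  rw [oldSubspace0]
  exact Submodule.mem_iSup_of_mem ⟨(32, d), hidx⟩ (LinearMap.mem_range_self _ _)

/-- **`dim S₂(Γ₀(64))^{old} ≥ 2`.** [cite: AtkinLehner1970, §2] -/
theorem two_le_finrank_oldSubspace0 : 2 ≤ Module.finrank ℂ (oldSubspace0 64 2) := by
  haveI : FiniteDimensional ℂ (CuspForm (Gamma0 64) 2) := finiteDimensional_cuspForm_gamma0 64 2
  have hv : LinearIndependent ℂ
      ![(⟨degeneracyMap0 32 64 1 2 cuspFormEtaProductThirtyTwo, degeneracyMap0_phi32_mem_old 1 (Or.inl rfl)⟩ : oldSubspace0 64 2),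
        ⟨degeneracyMap0 32 64 2 2 cuspFormEtaProductThirtyTwo, degeneracyMap0_phi32_mem_old 2 (Or.inr rfl)⟩] := by
    rw [LinearIndependent.pair_iff]
    intro s t hst
    have h' := congrArg Subtype.val hst
    simp only [Submodule.coe_add, Submodule.coe_smul, Submodule.coe_zero] at h'
    exact degeneracy_images_independent s t h'
  simpa using hv.fintype_card_le_finrank

/-- **`dim S₂(Γ₀(64))^{new} ≤ 1`** (`old ⊓ new = 0`, `dim old ≥ 2`, `dim = 3`). [cite: AtkinLehner1970, Thm. 5] -/
theorem finrank_newSubspace0_le_one : Module.finrank ℂ (newSubspace0 64 2) ≤ 1 := by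
  haveI : FiniteDimensional ℂ (CuspForm (Gamma0 64) 2) := finiteDimensional_cuspForm_gamma0 64 2
  have hsum := Submodule.finrank_sup_add_finrank_inf_eq (oldSubspace0 64 2) (newSubspace0 64 2)
  have hdisj : oldSubspace0 64 2 ⊓ newSubspace0 64 2 = ⊥ :=
    disjoint_iff.mp (disjoint_oldSubspace0_newSubspace0_holds (N := 64) (k := 2))
  rw [hdisj, finrank_bot, add_zero] at hsum
  have hle : Module.finrank ℂ ↥(oldSubspace0 64 2 ⊔ newSubspace0 64 2) ≤ 3 :=
    finrank_cuspForm_two_sixtyFour ▸ Submodule.finrank_le _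
  have h2 := two_le_finrank_oldSubspace0
  omega

/-- **Every element of `S₂(Γ₀(64))^{new}` is a multiple of `φ₆₄`.** [cite: AtkinLehner1970, Thm. 5] -/
theorem exists_eq_smul_phi64_of_mem_new (φ : CuspForm (Gamma0 64) 2)
    (hφ : ⇑φ = etaQuotient 64 (expFn [(4, -2), (8, 8), (16, -2)]))
    {g : CuspForm (Gamma0 64) 2} (hg : g ∈ newSubspace0 64 2) : ∃ c : ℂ, c • φ = g := by
  haveI : FiniteDimensional ℂ (CuspForm (Gamma0 64) 2) := finiteDimensional_cuspForm_gamma0 64 2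
  have hφn : (⟨φ, mem_newSubspace0_phi64 φ hφ⟩ : newSubspace0 64 2) ≠ 0 := by
    intro h
    exact (phi64_ne_zero_and_cuspCoeff_one φ hφ).1 (congrArg Subtype.val h)
  have h1 : Module.finrank ℂ (newSubspace0 64 2) = 1 := by
    refine le_antisymm finrank_newSubspace0_le_one ?_
    rw [Nat.one_le_iff_ne_zero, Ne, finrank_zero_iff_forall_zero, not_forall]
    exact ⟨_, hφn⟩
  obtain ⟨c, hc⟩ := (finrank_eq_one_iff_of_nonzero' _ hφn).mp h1 ⟨g, hg⟩
  exact ⟨c, by simpa using congrArg Subtype.val hc⟩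

/-- **Every newform of weight `2` on `Γ₀(64)` is `φ₆₄`** — FACT-FREE. [cite: MartinOno1997, Thm. 2] -/
theorem eq_phi64_of_isNewform0 (φ : CuspForm (Gamma0 64) 2)
    (hφ : ⇑φ = etaQuotient 64 (expFn [(4, -2), (8, 8), (16, -2)]))
    {g : CuspForm (Gamma0 64) 2} (hg : IsNewform0 g) : g = φ := by
  obtain ⟨c, hc⟩ := exists_eq_smul_phi64_of_mem_new φ hφ hg.1
  have h1 : cuspCoeff g 1 = 1 := hg.2.2
  have hc1 : c = 1 := by
    have h := congrArg (cuspCoeff · 1) hc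
    simp only [cuspCoeff_smul, h1, (phi64_ne_zero_and_cuspCoeff_one φ hφ).2, mul_one] at h
    exact h
  rw [← hc, hc1, one_smul]

/-- **Every `X₀(64)`-datum of every curve has newform `φ₆₄`** (as cusp forms). FACT-FREE. [cite: MartinOno1997, Thm. 2] -/
theorem f_eq_phi64 (φ : CuspForm (Gamma0 64) 2)
    (hφ : ⇑φ = etaQuotient 64 (expFn [(4, -2), (8, 8), (16, -2)]))
    {W : WeierstrassCurve ℚ} (D : ModularParametrizationData W 64) : D.f = φ :=
  eq_phi64_of_isNewform0 φ hφ D.isNewformOf.1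

/-- **Every `X₀(64)`-datum of every curve has newform `φ₆₄ = η₈⁸/(η₄²η₁₆²)`** (pointwise, definition-free form). FACT-FREE.
[cite: MartinOno1997, Thm. 2] -/
theorem f_apply_eq_phi64 {W : WeierstrassCurve ℚ} (D : ModularParametrizationData W 64) :
    ⇑D.f = etaQuotient 64 (expFn [(4, -2), (8, 8), (16, -2)]) := by
  obtain ⟨φ, hφ⟩ := exists_cuspForm_phi64
  rw [f_eq_phi64 φ hφ D, hφ]

end Summit.BirchSwinnertonDyer.BirchSwinnertonDyer.Theorems.ManinLocalTwoThree.NewformSixtyFour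

end
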